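import Mathlib
import Literature.NumberTheory.LFunctions.Zhang2022.Section16Lemma162RPackage
import Literature.NumberTheory.LFunctions.Zhang2022.Section16TwoFactorValue
import HarnessLib

/-!
# Zhang (2022), §16 Lemma 16.2 at the repaired normaliser (`Lemma162Rq`): the factor at `2 ∣ D` for
# every `s`, the shift sizes, and the sub-leaf MODULO THE PER-PRIME VALUES ONLY

Topic `Literature/NumberTheory/LFunctions/Zhang2022` (Landau–Siegel audit tree; verdict-neutral).
Y. Zhang, *Discrete mean estimates and the Landau–Siegel zero*, arXiv:2211.02515v1 (2022)
[Zhang2022LandauSiegel], §16 Lemma 16.2 p. 94 (tex L4646–L4653) and its Appendix-A sketch pp. 105–106,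
**an unrefereed manuscript under adjudication; nothing here asserts or denies its Theorems 1–2.**
Lane ZHANG-L, WP16 Block D (row G-d57-1), sub-leaf `Typed.Section16B.Lemma162Rq c′`; this file
continues `Section16Lemma162RPackage` (`Lemma162R.lemma162Rq_of_values (hdvd2) (hval)`).
THEOREMS (no definitions, no facts):

* `shift_error_le`, `shift_norms_eventually` — the
  shift sizes `δ_q = ‖q^{−β₁} − 1‖ + ‖q^{βⱼ} − 1‖ ≤ (‖β₁‖ + ‖βⱼ‖) log q ≤ 6α log q` (large `D`);
* `hval_of_shiftLipschitz` — ADAPTER: a per-prime value bound `≤ K·δ_q/q` (the shape of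
  `Section16Lemma162RPerturb`) gives the `hval` rate `C·α·log q/q`;
* `twoFactor_eq_of_apply_eq_zero`, `twoFactor_eq_two_dvd` — (D₂): for `χ(2) = 0`
  (`2 ∣ D`) the `2`-factor of `Lemma162R.hasProd_frakU2SeriesR` is `(1 − 2^{−s})²` for every `s` with
  `Re s > 0` (`ϖ₂ⱼ(2^e) = (2^{βⱼ})^e`, `Typed.Section16B.varpi2_two_pow_of_apply_eq_zero`;
  `(ν∗χ)(2^e) = 1`; geometric series) — the all-`s` form of `twoFactor_value_of_apply_eq_zero`;
* **`lemma162Rq_of_hval`** — `Lemma162Rq c′` from the per-prime VALUES at `s = 1` alone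
  (`q ∤ D`, `q ≤ D`: `‖Φ_q(1) − m_q‖ ≤ C·α·log q/q`);
* `hval_of_odd_two` (the merge of the interface of record, zl-w09-plan `SketchHval`) and
  **`lemma162Rq_of_odd_two (hodd) (htwo) : Lemma162Rq c′`** — the sub-leaf from the ODD-prime values
  (`HvalOdd`, zl-w09-p4) and the `2`-values (`HvalTwo`, zl-w09-p6).

WHAT THIS IS NOT: a proof of the per-prime values, or of anything about Theorems 1–2 /
Landau–Siegel zeros.

## References

* Y. Zhang, arXiv:2211.02515v1 (2022), §16 Lemma 16.2 p. 94; App. A pp. 105–106.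
  [cite: Zhang2022LandauSiegel, §16 Lemma 16.2 p.94]
-/
noncomputable section

open Complex Real Filter Topology Finset

namespace Literature.NumberTheory.LFunctions.Zhang2022.Lemma162R

open Literature.NumberTheory.LFunctions.Zhang2022
open Literature.NumberTheory.LFunctions.Zhang2022.Skeleton
open Literature.NumberTheory.LFunctions.Zhang2022.Typed.Section16A
open Literature.NumberTheory.LFunctions.Zhang2022.Typed.Section16B

/-! ## Shift sizes -/

/-- For a purely imaginary exponent `z` and `q ≥ 1`: `‖q^z − 1‖ ≤ ‖z‖·log q`. [folklore] -/
private theorem norm_natCast_cpow_sub_one_le_of_re_eq_zero {q : ℕ} (hq : 0 < q) {z : ℂ} (hz : z.re = 0) :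
    ‖(q : ℂ) ^ z - 1‖ ≤ ‖z‖ * Real.log q := by
  have hq0 : (q : ℂ) ≠ 0 := by exact_mod_cast hq.ne'
  have him : z = ((z.im : ℝ) : ℂ) * I := by
    apply Complex.ext <;> simp [hz]
  rw [Complex.cpow_def_of_ne_zero hq0, ← Complex.natCast_log, him]
  have e : (Real.log q : ℂ) * (((z.im : ℝ) : ℂ) * I) = I * ((Real.log q * z.im : ℝ) : ℂ) := by
    push_cast; ring
  rw [e]
  calc ‖Complex.exp (I * ((Real.log q * z.im : ℝ) : ℂ)) - 1‖
      ≤ ‖(Real.log q * z.im : ℝ)‖ := Real.norm_exp_I_mul_ofReal_sub_one_le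
    _ = ‖((z.im : ℝ) : ℂ) * I‖ * Real.log q := by
        rw [Real.norm_eq_abs, abs_mul, abs_of_nonneg (Real.log_natCast_nonneg q), mul_comm]
        simp

/-- `δ_q = ‖q^{−β₁} − 1‖ + ‖q^{βⱼ} − 1‖ ≤ (‖β₁‖ + ‖βⱼ‖)·log q`. [cite: Zhang2022LandauSiegel, §2 (2.13)] -/
theorem shift_error_le (c' : ℝ) (D j : ℕ) {q : ℕ} (hq : 0 < q) :
    ‖(q : ℂ) ^ (-beta1 c' D) - 1‖ + ‖(q : ℂ) ^ betaJ c' D j - 1‖ ≤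
      (‖beta1 c' D‖ + ‖betaJ c' D j‖) * Real.log q := by
  have h1 : (-beta1 c' D).re = 0 := by simp [beta1]
  have h2 : (betaJ c' D j).re = 0 := betaJ_re_eq_zero c' D j
  have a := norm_natCast_cpow_sub_one_le_of_re_eq_zero hq h1
  have b := norm_natCast_cpow_sub_one_le_of_re_eq_zero hq h2
  rw [norm_neg] at a
  calc _ ≤ ‖beta1 c' D‖ * Real.log q + ‖betaJ c' D j‖ * Real.log q := add_le_add a b
    _ = _ := by ring

/-- For all large `D` and `j = 1, 2`: `‖β₁‖ + ‖βⱼ‖ ≤ 6α`. [cite: Zhang2022LandauSiegel, §2 (2.13)] -/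
theorem shift_norms_eventually (c' : ℝ) :
    ForAllLarge fun D _ _ => ∀ j ∈ ({1, 2} : Finset ℕ),
      ‖beta1 c' D‖ + ‖betaJ c' D j‖ ≤ 6 * alpha D := by
  refine ForAllLarge.of_le ⌈Real.exp (5 * π * |c'| + 40)⌉₊ fun D _ χ hD _ _ j hj => ?_
  have hDexp : Real.exp (5 * π * |c'| + 40) ≤ D := le_trans (Nat.le_ceil _) (by exact_mod_cast hD)
  have hDpos : (0 : ℝ) < D := lt_of_lt_of_le (Real.exp_pos _) hDexp
  have hℓ : 5 * π * |c'| + 40 ≤ ell D := by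
    rw [ell]; exact (Real.le_log_iff_exp_le hDpos).mpr hDexp
  -- sizes (as in `Typed.Section16B.two_data_ne_zero`)
  have hπ3 := Real.pi_gt_three
  have hℓ40 : (40 : ℝ) ≤ ell D := by nlinarith [abs_nonneg c']
  have hℓ1 : 1 ≤ ell D := by linarith
  have hα : alpha D = π / ell D ^ 9 := by rw [alpha, bigP, Real.log_exp]
  have hα0 : 0 < alpha D := by rw [hα]; positivity
  have hαℓ : alpha D * ell D = π / ell D ^ 8 := by rw [hα]; field_simp
  have hαℓ0 : 0 ≤ alpha D * ell D := by positivity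
  have hcαℓ : |c'| * (alpha D * ell D) ≤ 1 / 5 := by
    rw [hαℓ]
    have h8 : ell D ≤ ell D ^ 8 := le_self_pow₀ hℓ1 (by norm_num)
    rw [← mul_div_assoc, div_le_iff₀ (by positivity)]
    nlinarith [abs_nonneg c', Real.pi_pos]
  have hc : |c' * (alpha D * ell D)| ≤ 1 / 5 := by
    rw [abs_mul, abs_of_nonneg hαℓ0]; exact hcαℓ
  have hβ1 : ‖beta1 c' D‖ ≤ 3 * alpha D := by
    have e : beta1 c' D = (((alpha D * (1 - 5 * c' * alpha D * ell D) : ℝ)) : ℂ) * I := by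
      rw [beta1]; push_cast; ring
    rw [e, norm_mul, Complex.norm_I, mul_one, Complex.norm_real, Real.norm_eq_abs, abs_mul,
      abs_of_pos hα0]
    have : |1 - 5 * c' * alpha D * ell D| ≤ 2 := by
      rw [abs_le]; constructor <;> nlinarith [abs_le.mp hc]
    nlinarith
  have hβ2 : ‖beta2 c' D‖ ≤ 3 * alpha D := by
    have e : beta2 c' D = (((2 * alpha D * (1 + c' * alpha D * ell D) : ℝ)) : ℂ) * I := by
      rw [beta2]; push_cast; ring
    rw [e, norm_mul, Complex.norm_I, mul_one, Complex.norm_real, Real.norm_eq_abs, abs_mul,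
      abs_of_pos (by positivity : (0:ℝ) < 2 * alpha D)]
    have : |1 + c' * alpha D * ell D| ≤ 3 / 2 := by
      rw [abs_le]; constructor <;> nlinarith [abs_le.mp hc]
    nlinarith
  have hj' : j = 1 ∨ j = 2 := by simpa using hj
  have hβj : ‖betaJ c' D j‖ ≤ 3 * alpha D := by
    rcases hj' with rfl | rfl
    · have e : betaJ c' D 1 = beta1 c' D := by simp [betaJ]
      rw [e]; exact hβ1
    · have e : betaJ c' D 2 = beta2 c' D := by simp [betaJ]
      rw [e]; exact hβ2
  linarith

/-- **Adapter: a shift-Lipschitz per-prime value bound gives the `hval` rate `α·log q/q`.** If for all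
large `D`, under (A), `j = 1, 2`, every prime `q ∤ D` with `q ≤ D` satisfies
`‖Φ_q(1) − m_q‖ ≤ K·(‖q^{−β₁} − 1‖ + ‖q^{βⱼ} − 1‖)/q`, then `‖Φ_q(1) − m_q‖ ≤ 6K·α·log q/q`
(`δ_q ≤ (‖β₁‖ + ‖βⱼ‖) log q ≤ 6α log q`). Generic in the value family `V` and the main terms `m`.
[cite: Zhang2022LandauSiegel, §16 Lemma 16.2 p.94; App. A p.106] -/
theorem hval_of_shiftLipschitz (c' : ℝ)
    (V : ∀ {D : ℕ} [NeZero D], DirichletCharacter ℂ D → ℕ → ℕ → ℂ)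
    (m : ∀ {D : ℕ} [NeZero D], DirichletCharacter ℂ D → ℕ → ℂ)
    (hpt : ∃ K : ℝ, ForAllLarge fun D _ χ => AssumptionA D χ → ∀ j ∈ ({1, 2} : Finset ℕ),
      ∀ q : ℕ, q.Prime → ¬ q ∣ D → (q : ℝ) ≤ D →
        ‖V χ j q - m χ q‖ ≤
          K * ((‖(q : ℂ) ^ (-beta1 c' D) - 1‖ + ‖(q : ℂ) ^ betaJ c' D j - 1‖) / q)) :
    ∃ C : ℝ, ForAllLarge fun D _ χ => AssumptionA D χ → ∀ j ∈ ({1, 2} : Finset ℕ),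
      ∀ q : ℕ, q.Prime → ¬ q ∣ D → (q : ℝ) ≤ D →
        ‖V χ j q - m χ q‖ ≤ C * (alpha D * Real.log q / q) := by
  obtain ⟨K, hpt⟩ := hpt
  set K' : ℝ := max K 0 with hK'def
  have hK'0 : 0 ≤ K' := le_max_right _ _
  refine ⟨6 * K', (hpt.and (shift_norms_eventually c')).mono
    fun D _ χ _ _ hS hA j hj q hqp hqD hqle => ?_⟩
  obtain ⟨hptD, hshD⟩ := hS
  have hq0 : (0 : ℝ) < q := by exact_mod_cast hqp.pos
  have hlog0 : 0 ≤ Real.log q := Real.log_natCast_nonneg q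
  have hα0 : 0 ≤ alpha D := by
    rw [alpha, bigP, Real.log_exp]
    have : 0 ≤ ell D := by rw [ell]; exact Real.log_natCast_nonneg D
    positivity
  have hδ := shift_error_le c' D j hqp.pos
  have h6 := hshD j hj
  set δ : ℝ := ‖(q : ℂ) ^ (-beta1 c' D) - 1‖ + ‖(q : ℂ) ^ betaJ c' D j - 1‖ with hδdef
  have hδ0 : 0 ≤ δ := by positivity
  have hδle : δ ≤ 6 * alpha D * Real.log q :=
    hδ.trans (by nlinarith [mul_le_mul_of_nonneg_right h6 hlog0])
  have h := hptD hA j hj q hqp hqD hqle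
  calc ‖V χ j q - m χ q‖ ≤ K * (δ / q) := h
    _ ≤ K' * (δ / q) := mul_le_mul_of_nonneg_right (le_max_left _ _) (by positivity)
    _ ≤ K' * (6 * alpha D * Real.log q / q) := by
        refine mul_le_mul_of_nonneg_left ?_ hK'0
        exact div_le_div_of_nonneg_right hδle hq0.le
    _ = 6 * K' * (alpha D * Real.log q / q) := by ring

/-! ## (D₂): the factor at `2` when `2 ∣ D`, for every `s` -/

/-- The `2`-factor for `χ(2) = 0` is `(1 − 2^{−s})²` for every `s` with `Re s > 0`
(given `𝓜₂*(1−βⱼ) ≠ 0`): `ϖ₂ⱼ(2^e) = (2^{βⱼ})^e` (`varpi2_two_pow_of_apply_eq_zero`), `(ν∗χ)(2^e) = 1`,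
geometric series against the factor `(1 − 2^{βⱼ}2^{−s})`. [cite: Zhang2022LandauSiegel, §16 Lemma 16.2 p.94] -/
theorem twoFactor_eq_of_apply_eq_zero (c' : ℝ) {D : ℕ} [NeZero D] (χ : DirichletCharacter ℂ D)
    (hv : χ (2 : ZMod D) = 0) (j : ℕ) (hstar : calM2star c' χ (1 - betaJ c' D j) ≠ 0)
    {s : ℂ} (hs : 0 < s.re) :
    (1 - (2 : ℂ) ^ (-s)) ^ 2 * (1 - (2 : ℂ) ^ betaJ c' D j * (2 : ℂ) ^ (-s)) *
          (1 - χ (2 : ZMod D) * (2 : ℂ) ^ (-s)) *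
            (1 - χ (2 : ZMod D) * ((2 : ℂ) ^ betaJ c' D j * (2 : ℂ) ^ (-s))) ^ 2 *
        (∑' e : ℕ, varpi2 c' χ j (2 ^ e) * nuConvChi χ (2 ^ e) * ((2 : ℂ) ^ (-s)) ^ e) =
      (1 - (2 : ℂ) ^ (-s)) ^ 2 := by
  set z : ℂ := (2 : ℂ) ^ betaJ c' D j with hz
  set x : ℂ := (2 : ℂ) ^ (-s) with hx
  have hznorm : ‖z‖ = 1 := by
    rw [hz, show (2 : ℂ) = ((2 : ℕ) : ℂ) by norm_num,
      Complex.norm_natCast_cpow_of_pos (by norm_num : 0 < 2), betaJ_re_eq_zero c' D j, Real.rpow_zero]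
  have hxnorm : ‖x‖ < 1 := by
    rw [hx, show (2 : ℂ) = ((2 : ℕ) : ℂ) by norm_num,
      Complex.norm_natCast_cpow_of_pos (by norm_num : 0 < 2), Complex.neg_re]
    exact Real.rpow_lt_one_of_one_lt_of_neg (by norm_num) (by linarith)
  have hv' : χ ((2 : ℕ) : ZMod D) = 0 := by exact_mod_cast hv
  have hterm : ∀ e : ℕ, varpi2 c' χ j (2 ^ e) * nuConvChi χ (2 ^ e) * x ^ e = (z * x) ^ e := by
    intro e
    rw [varpi2_two_pow_of_apply_eq_zero c' χ hv j hstar e,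
      Lemma162R.nuConvChi_prime_pow_of_apply_eq_zero χ Nat.prime_two hv' e, mul_one, ← mul_pow]
  have hr : ‖z * x‖ < 1 := by
    rw [norm_mul, hznorm, one_mul]; exact hxnorm
  have hsum : (∑' e : ℕ, varpi2 c' χ j (2 ^ e) * nuConvChi χ (2 ^ e) * x ^ e) = (1 - z * x)⁻¹ := by
    rw [tsum_congr hterm, tsum_geometric_of_norm_lt_one hr]
  have hne : (1 : ℂ) - z * x ≠ 0 := by
    intro h
    have h1 : z * x = 1 := by linear_combination -h
    rw [h1, norm_one] at hr
    exact lt_irrefl _ hr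
  have hne' : (1 : ℂ) - x * z ≠ 0 := by rwa [mul_comm] at hne
  rw [hsum, hv]
  field_simp
  ring

/-- **(D₂) for all large `D`**: under (A), `j = 1, 2`, `2 ∣ D`: the `2`-factor is `(1 − 2^{−s})²` on
`σ > 9/10` (`𝓜₂*(1−βⱼ) ≠ 0` from `Typed.Section16B.two_data_ne_zero`).
[cite: Zhang2022LandauSiegel, §16 Lemma 16.2 p.94] -/
theorem twoFactor_eq_two_dvd (c' : ℝ) :
    ForAllLarge fun D _ χ => AssumptionA D χ → ∀ j ∈ ({1, 2} : Finset ℕ), 2 ∣ D →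
      ∀ s : ℂ, 9 / 10 < s.re →
        (1 - (2 : ℂ) ^ (-s)) ^ 2 * (1 - (2 : ℂ) ^ betaJ c' D j * (2 : ℂ) ^ (-s)) *
              (1 - χ (2 : ZMod D) * (2 : ℂ) ^ (-s)) *
                (1 - χ (2 : ZMod D) * ((2 : ℂ) ^ betaJ c' D j * (2 : ℂ) ^ (-s))) ^ 2 *
            (∑' e : ℕ, varpi2 c' χ j (2 ^ e) * nuConvChi χ (2 ^ e) * ((2 : ℂ) ^ (-s)) ^ e) =
          (1 - (2 : ℂ) ^ (-s)) ^ 2 := by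
  refine (two_data_ne_zero c').mono fun D _ χ _ _ hS hA j hj h2 s hs => ?_
  obtain ⟨hstar, -⟩ := hS hA j hj
  have hv : χ (2 : ZMod D) = 0 := by
    have h : χ ((2 : ℕ) : ZMod D) = 0 := by
      apply χ.map_nonunit
      rw [ZMod.isUnit_iff_coprime]
      intro hcop
      have h1 : 2 ∣ Nat.gcd 2 D := Nat.dvd_gcd dvd_rfl h2
      rw [hcop] at h1
      exact absurd (Nat.dvd_one.mp h1) (by norm_num)
    exact_mod_cast h
  exact twoFactor_eq_of_apply_eq_zero c' χ hv j hstar (by linarith)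

/-! ## The plug modulo the values at `s = 1` -/

open scoped Classical in
/-- **`Lemma162Rq c′` from the per-prime VALUES alone** ((D₂) discharged by
`twoFactor_eq_two_dvd`). [cite: Zhang2022LandauSiegel, §16 Lemma 16.2 p.94] -/
theorem lemma162Rq_of_hval (c' : ℝ)
    (hval : ∃ C : ℝ, ForAllLarge fun D _ χ => AssumptionA D χ → ∀ j ∈ ({1, 2} : Finset ℕ),
      ∀ q : ℕ, q.Prime → ¬ q ∣ D → (q : ℝ) ≤ D →
        ‖(1 - (q : ℂ) ^ (-(1 : ℂ))) ^ 2 * (1 - (q : ℂ) ^ betaJ c' D j * (q : ℂ) ^ (-(1 : ℂ))) *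
                (1 - χ (q : ZMod D) * (q : ℂ) ^ (-(1 : ℂ))) *
                  (1 - χ (q : ZMod D) * ((q : ℂ) ^ betaJ c' D j * (q : ℂ) ^ (-(1 : ℂ)))) ^ 2 *
              (if q = 2 then
                  ∑' e : ℕ, varpi2 c' χ j (2 ^ e) * nuConvChi χ (2 ^ e) * ((2 : ℂ) ^ (-(1 : ℂ))) ^ e
                else ∑' e : ℕ, varpi2loc c' χ j (q ^ e) * nuConvChi χ (q ^ e) *
                  ((q : ℂ) ^ (-(1 : ℂ))) ^ e) -
            (if q = 2 ∧ χ (2 : ZMod D) = 1 then (3 / 8 : ℂ)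
              else (1 - (((q : ℂ)) ^ 2)⁻¹) / frakpFactor χ q)‖ ≤
          C * (alpha D * Real.log q / q)) :
    Lemma162Rq c' :=
  lemma162Rq_of_values c' (twoFactor_eq_two_dvd c') hval

open scoped Classical in
/-- **THE MERGE** (interface of record, zl-w09-plan `SketchHval`): the odd-prime values (`HvalOdd`:
`q` prime, `q ≠ 2`, `q ∤ D`, `q ≤ D`) and the `2`-values (`HvalTwo`: `2 ∤ D`, branches `χ(2) = ±1`)
give the `hval` binder of `lemma162Rq_of_values` (`C := max C₁ C₂`, case split `q = 2`).
[cite: Zhang2022LandauSiegel, §16 Lemma 16.2 p.94; App. A p.106] -/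
theorem hval_of_odd_two (c' : ℝ)
    (hodd : ∃ C : ℝ, ForAllLarge fun D _ χ => AssumptionA D χ → ∀ j ∈ ({1, 2} : Finset ℕ),
      ∀ q : ℕ, q.Prime → q ≠ 2 → ¬ q ∣ D → (q : ℝ) ≤ D →
        ‖(1 - (q : ℂ) ^ (-(1 : ℂ))) ^ 2 * (1 - (q : ℂ) ^ betaJ c' D j * (q : ℂ) ^ (-(1 : ℂ))) *
                (1 - χ (q : ZMod D) * (q : ℂ) ^ (-(1 : ℂ))) *
                  (1 - χ (q : ZMod D) * ((q : ℂ) ^ betaJ c' D j * (q : ℂ) ^ (-(1 : ℂ)))) ^ 2 *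
              (∑' e : ℕ, varpi2loc c' χ j (q ^ e) * nuConvChi χ (q ^ e) * ((q : ℂ) ^ (-(1 : ℂ))) ^ e) -
            (1 - (((q : ℂ)) ^ 2)⁻¹) / frakpFactor χ q‖ ≤ C * (alpha D * Real.log q / q))
    (htwo : ∃ C : ℝ, ForAllLarge fun D _ χ => AssumptionA D χ → ∀ j ∈ ({1, 2} : Finset ℕ),
      ¬ 2 ∣ D →
        ‖(1 - (2 : ℂ) ^ (-(1 : ℂ))) ^ 2 * (1 - (2 : ℂ) ^ betaJ c' D j * (2 : ℂ) ^ (-(1 : ℂ))) *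
                (1 - χ (2 : ZMod D) * (2 : ℂ) ^ (-(1 : ℂ))) *
                  (1 - χ (2 : ZMod D) * ((2 : ℂ) ^ betaJ c' D j * (2 : ℂ) ^ (-(1 : ℂ)))) ^ 2 *
              (∑' e : ℕ, varpi2 c' χ j (2 ^ e) * nuConvChi χ (2 ^ e) * ((2 : ℂ) ^ (-(1 : ℂ))) ^ e) -
            (if χ (2 : ZMod D) = 1 then (3 / 8 : ℂ) else (1 - ((2 : ℂ) ^ 2)⁻¹) / frakpFactor χ 2)‖ ≤
          C * (alpha D * Real.log 2 / 2)) :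
    ∃ C : ℝ, ForAllLarge fun D _ χ => AssumptionA D χ → ∀ j ∈ ({1, 2} : Finset ℕ),
      ∀ q : ℕ, q.Prime → ¬ q ∣ D → (q : ℝ) ≤ D →
        ‖(1 - (q : ℂ) ^ (-(1 : ℂ))) ^ 2 * (1 - (q : ℂ) ^ betaJ c' D j * (q : ℂ) ^ (-(1 : ℂ))) *
                (1 - χ (q : ZMod D) * (q : ℂ) ^ (-(1 : ℂ))) *
                  (1 - χ (q : ZMod D) * ((q : ℂ) ^ betaJ c' D j * (q : ℂ) ^ (-(1 : ℂ)))) ^ 2 *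
              (if q = 2 then
                  ∑' e : ℕ, varpi2 c' χ j (2 ^ e) * nuConvChi χ (2 ^ e) * ((2 : ℂ) ^ (-(1 : ℂ))) ^ e
                else ∑' e : ℕ, varpi2loc c' χ j (q ^ e) * nuConvChi χ (q ^ e) *
                  ((q : ℂ) ^ (-(1 : ℂ))) ^ e) -
            (if q = 2 ∧ χ (2 : ZMod D) = 1 then (3 / 8 : ℂ)
              else (1 - (((q : ℂ)) ^ 2)⁻¹) / frakpFactor χ q)‖ ≤
          C * (alpha D * Real.log q / q) := by
  obtain ⟨C₁, h₁⟩ := hodd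
  obtain ⟨C₂, h₂⟩ := htwo
  refine ⟨max C₁ C₂, (h₁.and h₂).mono fun D _ χ _ _ hS hA j hj q hqp hnd hqD => ?_⟩
  obtain ⟨h₁, h₂⟩ := hS
  have hα : 0 ≤ alpha D := by
    simp only [alpha, bigP, Real.log_exp]
    exact div_nonneg Real.pi_pos.le (pow_nonneg (Real.log_natCast_nonneg D) 9)
  have hx : 0 ≤ alpha D * Real.log q / q :=
    div_nonneg (mul_nonneg hα (Real.log_natCast_nonneg q)) (Nat.cast_nonneg q)
  by_cases hq2 : q = 2
  · subst hq2
    have h := h₂ hA j hj hnd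
    simp only [if_true, true_and, Nat.cast_ofNat] at h ⊢
    exact h.trans (mul_le_mul_of_nonneg_right (le_max_right _ _) hx)
  · have h := h₁ hA j hj q hqp hq2 hnd hqD
    simp only [hq2, if_false, false_and] at h ⊢
    exact h.trans (mul_le_mul_of_nonneg_right (le_max_left _ _) hx)

open scoped Classical in
/-- **`Lemma162Rq c′` from the odd-prime values and the `2`-values** — the PLUG is
`lemma162Rq_of_odd_two c′ (hval_odd c′) (hval_two c′)` once the two value theorems land (texts =
`HvalOdd` / `HvalTwo` of the interface of record). [cite: Zhang2022LandauSiegel, §16 Lemma 16.2 p.94] -/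
theorem lemma162Rq_of_odd_two (c' : ℝ)
    (hodd : ∃ C : ℝ, ForAllLarge fun D _ χ => AssumptionA D χ → ∀ j ∈ ({1, 2} : Finset ℕ),
      ∀ q : ℕ, q.Prime → q ≠ 2 → ¬ q ∣ D → (q : ℝ) ≤ D →
        ‖(1 - (q : ℂ) ^ (-(1 : ℂ))) ^ 2 * (1 - (q : ℂ) ^ betaJ c' D j * (q : ℂ) ^ (-(1 : ℂ))) *
                (1 - χ (q : ZMod D) * (q : ℂ) ^ (-(1 : ℂ))) *
                  (1 - χ (q : ZMod D) * ((q : ℂ) ^ betaJ c' D j * (q : ℂ) ^ (-(1 : ℂ)))) ^ 2 *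
              (∑' e : ℕ, varpi2loc c' χ j (q ^ e) * nuConvChi χ (q ^ e) * ((q : ℂ) ^ (-(1 : ℂ))) ^ e) -
            (1 - (((q : ℂ)) ^ 2)⁻¹) / frakpFactor χ q‖ ≤ C * (alpha D * Real.log q / q))
    (htwo : ∃ C : ℝ, ForAllLarge fun D _ χ => AssumptionA D χ → ∀ j ∈ ({1, 2} : Finset ℕ),
      ¬ 2 ∣ D →
        ‖(1 - (2 : ℂ) ^ (-(1 : ℂ))) ^ 2 * (1 - (2 : ℂ) ^ betaJ c' D j * (2 : ℂ) ^ (-(1 : ℂ))) *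
                (1 - χ (2 : ZMod D) * (2 : ℂ) ^ (-(1 : ℂ))) *
                  (1 - χ (2 : ZMod D) * ((2 : ℂ) ^ betaJ c' D j * (2 : ℂ) ^ (-(1 : ℂ)))) ^ 2 *
              (∑' e : ℕ, varpi2 c' χ j (2 ^ e) * nuConvChi χ (2 ^ e) * ((2 : ℂ) ^ (-(1 : ℂ))) ^ e) -
            (if χ (2 : ZMod D) = 1 then (3 / 8 : ℂ) else (1 - ((2 : ℂ) ^ 2)⁻¹) / frakpFactor χ 2)‖ ≤
          C * (alpha D * Real.log 2 / 2)) :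
    Lemma162Rq c' :=
  lemma162Rq_of_hval c' (hval_of_odd_two c' hodd htwo)

end Literature.NumberTheory.LFunctions.Zhang2022.Lemma162R

end
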